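import Mathlib
import HarnessLib

/-!
# Truncated products of contractions: the operator-norm budget of a character cut, and pruning between factors

HONEST FRAMING: elementary normed-ring / normed-space inequalities (telescoping).  They are the two error budgets every
kept-set transfer-matrix engine of the Y3 FLOW-DATA track DECLARES but no tree theorem stated in the shape the engines use:

1. **Truncated product.**  The exact plaquette factors are contractions (`‖f_p‖ ≤ 1`, since `0 ≤ exp(β(½Tr U_p − 1)) ≤ 1`);
   each is replaced by a character-cut factor `f̃_p` with `‖f_p − f̃_p‖ ≤ τ_p` and `‖f̃_p‖ ≤ c_p` (typically `c_p = 1 + τ_p`).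
   Then `‖∏ f_p − ∏ f̃_p‖ ≤ B` with `B` the recursive budget `B(p :: rest) = τ_p + c_p · B(rest)`, `B([]) = 0`
   (`norm_prod_sub_prod_le_foldr`, the budget written as a `List.foldr`); all `c_p = 1` gives `Σ τ_p` (`norm_prod_sub_prod_le_sum`), and two factors give
   lineage A-t211's `τ_P = τ_A + (1 + τ_A) τ_B` (`norm_mul_sub_mul_le_tauP`).  Any operator-norm bound of this kind is what
   the Weyl transport door (`Literature.Analysis.Matrix.EigenvalueEnclosureTransport`) and the matrix-free matvec door
   (`FlowData.MatrixFreeLevel.residual_norm_le_of_approx`) consume.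
2. **Pruning between factors.**  If a vector is pushed through contractions `F₁, …, F_m` and after each factor an arbitrary
   perturbation `δ_i` is added (amplitude pruning: the dropped part, whose norm the run knows exactly), the end result differs
   from the exact push by at most `Σ ‖δ_i‖` (`norm_foldl_perturbed_sub_foldl_le`), and more generally by
   `‖x − x'‖ + Σ ‖δ_i‖` for different starting vectors.

Stated for an arbitrary normed ring with `‖1‖ = 1` (part 1) and for continuous linear maps on a normed space (part 2); no
matrices, lattices or physics; no definitions (budgets and pushes are written as `List.foldr` / `List.foldl`); no named facts.

## References
* [HornJohnson2013] R. A. Horn, C. R. Johnson, *Matrix Analysis*, 2nd ed., CUP 2013 — §5.6 (submultiplicative norms),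
  the only input; the telescoping identities are folklore.
* [Higham2002] N. J. Higham, *Accuracy and Stability of Numerical Algorithms*, 2nd ed., SIAM 2002 — §3.1–3.3 (running error
  budgets for products), for the shape of the recursive budget.
-/

namespace Summit.Ventures.YMGap.FlowData

namespace TruncatedProduct

/-! ### §1 Truncated products in a normed ring -/

section Ring

variable {R : Type*} [NormedRing R] [NormOneClass R] {ι : Type*}

/-! The recursive operator-norm budget of an ordered truncated product is written inline as
`l.foldr (fun i acc => τ i + c i * acc) 0`, i.e. `B([]) = 0`, `B(i :: l) = τ i + c i · B(l)` (no new definition). -/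

/-- A product of contractions is a contraction (`‖1‖ = 1` for the empty product). [folklore] -/
theorem norm_prod_le_one (x : ι → R) (l : List ι) (hx : ∀ i ∈ l, ‖x i‖ ≤ 1) : ‖(l.map x).prod‖ ≤ 1 := by
  induction l with
  | nil => simp
  | cons i l ih =>
    rw [List.map_cons, List.prod_cons]
    have h1 := hx i List.mem_cons_self
    have h2 := ih fun j hj => hx j (List.mem_cons_of_mem _ hj)
    calc ‖x i * (l.map x).prod‖ ≤ ‖x i‖ * ‖(l.map x).prod‖ := norm_mul_le _ _
      _ ≤ 1 * 1 := mul_le_mul h1 h2 (norm_nonneg _) zero_le_one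
      _ = 1 := one_mul _

/-- **Truncated product, recursive budget.** Exact factors contractions (`‖x i‖ ≤ 1`), truncated factors bounded
(`‖y i‖ ≤ c i`), per-factor truncation errors `‖x i − y i‖ ≤ τ i` ⇒ `‖∏ x − ∏ y‖ ≤ B(l)` for the ordered products, `B(i :: l) = τ i + c i · B(l)`, `B([]) = 0`.
[folklore; cite: HornJohnson2013, §5.6] -/
theorem norm_prod_sub_prod_le_foldr (x y : ι → R) (c τ : ι → ℝ) (l : List ι) (hx : ∀ i ∈ l, ‖x i‖ ≤ 1)
    (hy : ∀ i ∈ l, ‖y i‖ ≤ c i) (hxy : ∀ i ∈ l, ‖x i - y i‖ ≤ τ i) :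
    ‖(l.map x).prod - (l.map y).prod‖ ≤ l.foldr (fun i acc => τ i + c i * acc) 0 := by
  induction l with
  | nil => simp
  | cons i l ih =>
    rw [List.map_cons, List.map_cons, List.prod_cons, List.prod_cons, List.foldr_cons]
    have hxi := hx i List.mem_cons_self
    have hyi := hy i List.mem_cons_self
    have hxyi := hxy i List.mem_cons_self
    have ih' := ih (fun j hj => hx j (List.mem_cons_of_mem _ hj)) (fun j hj => hy j (List.mem_cons_of_mem _ hj))
      (fun j hj => hxy j (List.mem_cons_of_mem _ hj))
    have hX := norm_prod_le_one x l fun j hj => hx j (List.mem_cons_of_mem _ hj)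
    have hid : x i * (l.map x).prod - y i * (l.map y).prod =
        (x i - y i) * (l.map x).prod + y i * ((l.map x).prod - (l.map y).prod) := by
      rw [sub_mul, mul_sub]; abel
    rw [hid]
    have hτ : 0 ≤ τ i := (norm_nonneg _).trans hxyi
    have hc : 0 ≤ c i := (norm_nonneg _).trans hyi
    calc ‖(x i - y i) * (l.map x).prod + y i * ((l.map x).prod - (l.map y).prod)‖
        ≤ ‖(x i - y i) * (l.map x).prod‖ + ‖y i * ((l.map x).prod - (l.map y).prod)‖ := norm_add_le _ _
      _ ≤ ‖x i - y i‖ * ‖(l.map x).prod‖ + ‖y i‖ * ‖(l.map x).prod - (l.map y).prod‖ :=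
          add_le_add (norm_mul_le _ _) (norm_mul_le _ _)
      _ ≤ τ i * 1 + c i * l.foldr (fun i acc => τ i + c i * acc) 0 :=
          add_le_add (mul_le_mul hxyi hX (norm_nonneg _) hτ) (mul_le_mul hyi ih' (norm_nonneg _) hc)
      _ = τ i + c i * l.foldr (fun i acc => τ i + c i * acc) 0 := by rw [mul_one]

/-- With all truncated factors themselves contractions the budget is the plain sum `Σ τ i`. [folklore] -/
theorem foldr_budget_eq_sum_of_one (τ : ι → ℝ) (l : List ι) :
    l.foldr (fun i acc => τ i + (fun _ => (1 : ℝ)) i * acc) 0 = (l.map τ).sum := by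
  induction l with
  | nil => simp
  | cons i l ih => rw [List.foldr_cons, ih, List.map_cons, List.sum_cons, one_mul]

/-- **Truncated product of contractions by contractions**: `‖∏ x − ∏ y‖ ≤ Σ τ i`. [folklore; cite: HornJohnson2013, §5.6] -/
theorem norm_prod_sub_prod_le_sum (x y : ι → R) (τ : ι → ℝ) (l : List ι) (hx : ∀ i ∈ l, ‖x i‖ ≤ 1)
    (hy : ∀ i ∈ l, ‖y i‖ ≤ 1) (hxy : ∀ i ∈ l, ‖x i - y i‖ ≤ τ i) :
    ‖(l.map x).prod - (l.map y).prod‖ ≤ (l.map τ).sum := by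
  rw [← foldr_budget_eq_sum_of_one]
  exact norm_prod_sub_prod_le_foldr x y (fun _ => 1) τ l hx hy hxy

omit [NormOneClass R] in
/-- **Two factors** (lineage A-t211's `τ_P`): `‖b‖ ≤ 1`, `‖a − a'‖ ≤ τ_A`, `‖b − b'‖ ≤ τ_B`, `‖a'‖ ≤ 1 + τ_A` ⇒
`‖a b − a' b'‖ ≤ τ_A + (1 + τ_A) τ_B` (from `a b − a' b' = (a − a') b + a' (b − b')`). [folklore; cite: HornJohnson2013, §5.6] -/
theorem norm_mul_sub_mul_le_tauP {a b a' b' : R} {τA τB : ℝ} (hb : ‖b‖ ≤ 1) (haa : ‖a - a'‖ ≤ τA)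
    (hbb : ‖b - b'‖ ≤ τB) (ha' : ‖a'‖ ≤ 1 + τA) : ‖a * b - a' * b'‖ ≤ τA + (1 + τA) * τB := by
  have hid : a * b - a' * b' = (a - a') * b + a' * (b - b') := by
    rw [sub_mul, mul_sub]; abel
  rw [hid]
  have hτA : 0 ≤ τA := (norm_nonneg _).trans haa
  have hτB : 0 ≤ τB := (norm_nonneg _).trans hbb
  calc ‖(a - a') * b + a' * (b - b')‖ ≤ ‖(a - a') * b‖ + ‖a' * (b - b')‖ := norm_add_le _ _
    _ ≤ ‖a - a'‖ * ‖b‖ + ‖a'‖ * ‖b - b'‖ := add_le_add (norm_mul_le _ _) (norm_mul_le _ _)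
    _ ≤ τA * 1 + (1 + τA) * τB :=
        add_le_add (mul_le_mul haa hb (norm_nonneg _) hτA) (mul_le_mul ha' hbb (norm_nonneg _) (by linarith))
    _ = τA + (1 + τA) * τB := by rw [mul_one]

omit [NormOneClass R] in
/-- The truncated factor's own norm from the exact one: `‖a‖ ≤ 1`, `‖a − a'‖ ≤ τ` ⇒ `‖a'‖ ≤ 1 + τ`. [folklore] -/
theorem norm_le_one_add_of_norm_sub_le {a a' : R} {τ : ℝ} (ha : ‖a‖ ≤ 1) (haa : ‖a - a'‖ ≤ τ) : ‖a'‖ ≤ 1 + τ := by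
  have h : a' = a - (a - a') := by abel
  rw [h]
  exact (norm_sub_le _ _).trans (add_le_add ha haa)

end Ring

/-! ### §2 Pruning between contractions -/

section Pruning

variable {𝕜 : Type*} [NontriviallyNormedField 𝕜] {E : Type*} [NormedAddCommGroup E] [NormedSpace 𝕜 E]

/-! The exact push of a vector `x` through a list of (map, perturbation) pairs is `steps.foldl (fun v s => s.1 v) x`;
the perturbed push, adding each step's perturbation (the pruned part, sign included) after its map, is
`steps.foldl (fun v s => s.1 v + s.2) x` (written inline; no new definition). -/

/-- **Pruning between contractions.** If every map is a contraction (`‖F_i‖ ≤ 1`), the perturbed push from `x` and the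
exact push from `x'` differ by at most `‖x − x'‖ + Σ ‖δ_i‖`. [folklore] -/
theorem norm_foldl_perturbed_sub_foldl_le (steps : List ((E →L[𝕜] E) × E)) (hF : ∀ s ∈ steps, ‖s.1‖ ≤ 1) (x x' : E) :
    ‖steps.foldl (fun v s => s.1 v + s.2) x - steps.foldl (fun v s => s.1 v) x'‖ ≤
      ‖x - x'‖ + (steps.map fun s => ‖s.2‖).sum := by
  induction steps generalizing x x' with
  | nil => simp
  | cons s steps ih =>
    rw [List.foldl_cons, List.foldl_cons, List.map_cons, List.sum_cons]
    have hs := hF s List.mem_cons_self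
    have ih' := ih (fun t ht => hF t (List.mem_cons_of_mem _ ht)) (s.1 x + s.2) (s.1 x')
    have hstep : ‖s.1 x + s.2 - s.1 x'‖ ≤ ‖x - x'‖ + ‖s.2‖ := by
      have hid : s.1 x + s.2 - s.1 x' = s.1 (x - x') + s.2 := by rw [map_sub]; abel
      rw [hid]
      refine (norm_add_le _ _).trans (add_le_add ?_ le_rfl)
      exact (s.1.le_opNorm _).trans (by simpa using mul_le_mul_of_nonneg_right hs (norm_nonneg (x - x')))
    linarith

/-- Same start: the pruned push differs from the exact one by at most the total pruned norm `Σ ‖δ_i‖`. [folklore] -/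
theorem norm_foldl_perturbed_sub_foldl_self_le (steps : List ((E →L[𝕜] E) × E)) (hF : ∀ s ∈ steps, ‖s.1‖ ≤ 1)
    (x : E) :
    ‖steps.foldl (fun v s => s.1 v + s.2) x - steps.foldl (fun v s => s.1 v) x‖ ≤ (steps.map fun s => ‖s.2‖).sum := by
  simpa using norm_foldl_perturbed_sub_foldl_le steps hF x x

end Pruning

end TruncatedProduct

end Summit.Ventures.YMGap.FlowData
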